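import Summits.QuantumFields.BalabanUV.Gaps.EndDrawdownLinearThresholdLower
import Mathlib.Analysis.SpecialFunctions.Sqrt

/-!
# Gaps / EndDrawdownLinearThresholdFlow — THE ODE BLOCK MAP `w ↦ 4·Φ₇(w)` HAS A FIXED POINT IFF `C ≤ √(84∕(77 + 72·log 2))`

Companion of `EndDrawdownLinearThresholdConstant` (X16).  There the halving equation `T_C(v) − T_C(v∕2) = 7` of the reading note
`g1/THRESHOLD-READING-P3.md` §4 was decided (`exists_halving_iff`); here the FLOW itself is built, so that the note's step (5) — «the scaled backward
ODE block map `M_C(w) = 4·Φ₇(w)`, `Φ` the flow of `ẇ = C∕√w − 1`, has a fixed point iff `C² ψ_min ≤ 7`» — becomes a statement about a defined map.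
CONSTRUCTION (`0 < C` throughout): `T_C` is strictly increasing on `(C, ∞)` (X18 `EndDrawdownLinearThresholdLower.flowTime_strictMonoOn`) and takes every real value there
(**`exists_flowTime_eq`**: logarithmic end at `v ↓ C`, quadratic end at `v → ∞`), so `vFlow C τ v := T_C⁻¹(T_C(v) − τ) ∈ (C, ∞)` is defined for EVERY
`τ` (**`vFlow_spec`**; `Function.invFunOn`); it is a flow — **`vFlow_zero`**, **`vFlow_add`** — moving DOWN for `τ > 0` (**`vFlow_lt`**), and it IS the
backward flow of `ẇ = C∕√w − 1` written in `v = √w` in the uniqueness sense: every differentiable solution of `v̇ = (C − v)∕(2v²)` staying in `v > C`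
on `[0, τ₀]` is `t ↦ vFlow C t (v 0)` (**`eq_vFlow_of_solution`**, from X16's `hasDerivAt_flowTime_comp`), and every differentiable solution of
`ẇ = C∕√w − 1` staying in `w > C²` is `t ↦ Phi C t (w 0)` with `Phi C τ w := (vFlow C τ √w)²` (**`eq_Phi_of_solution`**).  THE BLOCK MAP
`blockMapODE C w := 4·Phi C 7 w` (duration `7` = the `7·8^t` unit steps of block `t` at step `8^{−t}`; factor `4` = the rescaling `4^t → 4^{t−1}`):
**`blockMapODE_fixed_iff`** (`C² < w`: `M_C(w) = w ⟺ 2C < √w ∧ T_C(√w) − T_C(√w∕2) = 7`), hence **`exists_fixedPoint_iff`**: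
`(∃ w > C², M_C(w) = w) ⟺ C ≤ cStarConj = √(84∕(77 + 72·log 2))`; below the constant TWO fixed points astride `w⋆ = (7C∕3)²`
(**`exists_two_fixedPoints`** — the note's `w₁ < w₂`), AT the constant the unique fixed point `w⋆ = (7·cStarConj∕3)²` (**`fixedPoint_unique_at_cStarConj`**,
**`blockMapODE_fixed_at_cStarConj`**).

WHAT IS NOT HERE (and is NOT claimed): that the seat's discrete threshold `C⋆(bOct)` equals `cStarConj` — steps (1)–(3) of the note's §4b (uniform
convergence of the `7·8^t`-step implicit Euler block maps to `M_C` with summable errors, and the two comparison arguments through X10 ∕ X8) are NOT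
formalised; nothing here mentions `EndPossibleLin`.  Existence of a DIFFERENTIABLE solution through every point is not proved either (only that any
solution is the constructed flow); `vFlow` ∕ `Phi` carry junk values for `C ≤ 0` or off their domains (never used).  (cell pub-balaban-gaps, seat g1-p3
GEN 12, rows CAP ∕ tail «split ∕ weakening»; own leaf; file 35 of «the one-loop interface of the END statement»; imports X18 (hence X16).)

HONEST FRAMING (cell rule, page 1 of everything): [folklore] one-variable calculus (inverse of a strictly monotone continuous function via the
intermediate value theorem; constancy from a vanishing derivative) for ONE explicit scalar ODE attached to ONE toy sequence of the seat's END-grade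
reading; `cStarConj` is a CONJECTURED toy-threshold value; 0 binders of Bałaban's discharged; 0 coefficients certified; words ∕ odds of rows
CAP ∕ tail ∕ (D4) ∕ (D1) UNCHANGED; one finite T⁴; NOT [I] Thm 2, NOT `BetaPertH`, NOT the continuum limit, NOT Clay.
-/

namespace Summit.QuantumFields.BalabanUV.Gaps.EndDrawdownLinearThresholdFlow

open Real Set
open Summit.QuantumFields.BalabanUV.Gaps.EndDrawdownLinearThresholdConstant
open Summit.QuantumFields.BalabanUV.Gaps.EndDrawdownLinearThresholdLower (flowTime_strictMonoOn flowTime_injOn)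

noncomputable section

/-! ## §1 `T_C` takes every real value on `(C, ∞)` (`0 < C`; strict monotonicity is X18's `flowTime_strictMonoOn`) -/

/-- The logarithmic end: `T_C(C + e^{−M}) ≤ (C+1)² + 2C(C+1) − 2C²·M` for `M ≥ 0`. [folklore] -/
theorem flowTime_near_left_le {C M : ℝ} (hC : 0 < C) (hM : 0 ≤ M) :
    flowTime C (C + Real.exp (-M)) ≤ (C + 1) ^ 2 + 2 * C * (C + 1) - 2 * C ^ 2 * M := by
  have he : 0 < Real.exp (-M) := Real.exp_pos _
  have he1 : Real.exp (-M) ≤ 1 := Real.exp_le_one_iff.mpr (by linarith)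
  simp only [flowTime, add_sub_cancel_left, Real.log_exp]
  nlinarith

/-- The quadratic end: `v² ≤ T_C(v)` for `v ≥ C + 1`. [folklore] -/
theorem sq_le_flowTime {C v : ℝ} (hC : 0 < C) (hv : C + 1 ≤ v) : v ^ 2 ≤ flowTime C v := by
  have hlog : 0 ≤ Real.log (v - C) := Real.log_nonneg (by linarith)
  simp only [flowTime]
  nlinarith

/-- `T_C` takes every real value on `(C, ∞)` (intermediate value theorem between the two ends). [folklore] -/
theorem exists_flowTime_eq {C : ℝ} (hC : 0 < C) (s : ℝ) : ∃ v, C < v ∧ flowTime C v = s := by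
  set M : ℝ := |(C + 1) ^ 2 + 2 * C * (C + 1) - s| / (2 * C ^ 2) + 1 with hM
  have hC2 : 0 < 2 * C ^ 2 := by positivity
  have hM0 : 0 ≤ M := by rw [hM]; positivity
  set a : ℝ := C + Real.exp (-M) with ha
  set b : ℝ := max (C + 1) (|s| + 1) with hb
  have hea : 0 < Real.exp (-M) := Real.exp_pos _
  have hea1 : Real.exp (-M) ≤ 1 := Real.exp_le_one_iff.mpr (by linarith)
  have haC : C < a := by rw [ha]; linarith
  have hab : a ≤ b := by rw [ha, hb]; exact le_trans (by linarith) (le_max_left _ _)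
  have hTa : flowTime C a < s := by
    have h1 := flowTime_near_left_le hC hM0
    have h2 : |(C + 1) ^ 2 + 2 * C * (C + 1) - s| < 2 * C ^ 2 * M := by
      have key : 2 * C ^ 2 * M = |(C + 1) ^ 2 + 2 * C * (C + 1) - s| + 2 * C ^ 2 := by
        rw [hM]
        field_simp
      linarith
    have h3 := le_abs_self ((C + 1) ^ 2 + 2 * C * (C + 1) - s)
    rw [ha]
    linarith
  have hTb : s < flowTime C b := by
    have h1 := sq_le_flowTime hC (le_max_left (C + 1) (|s| + 1))
    have hb1 : |s| + 1 ≤ b := le_max_right _ _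
    have hb0 : 1 ≤ b := le_trans (by linarith [abs_nonneg s]) hb1
    have h2 : b ≤ b ^ 2 := by nlinarith
    have h3 := le_abs_self s
    rw [hb] at *
    linarith
  have hcont : ContinuousOn (flowTime C) (Icc a b) := fun v hv =>
    (hasDerivAt_flowTime (lt_of_lt_of_le haC hv.1)).continuousAt.continuousWithinAt
  obtain ⟨v, hvmem, hv⟩ := intermediate_value_Icc hab hcont ⟨hTa.le, hTb.le⟩
  exact ⟨v, lt_of_lt_of_le haC hvmem.1, hv⟩

/-! ## §2 The backward flow in `v = √w`: `vFlow C τ v = T_C⁻¹(T_C(v) − τ)` -/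

/-- The backward flow of `ẇ = C∕√w − 1` in the coordinate `v = √w`: the point of `(C, ∞)` reached from `v` after time `τ`, i.e. the unique
`u > C` with `T_C(u) = T_C(v) − τ` (`Function.invFunOn`; junk if no such `u`, which for `0 < C` never happens). [folklore] -/
def vFlow (C τ v : ℝ) : ℝ := Function.invFunOn (flowTime C) (Ioi C) (flowTime C v - τ)

/-- Specification: `vFlow C τ v > C` and `T_C(vFlow C τ v) = T_C(v) − τ`. [folklore] -/
theorem vFlow_spec {C : ℝ} (hC : 0 < C) (τ v : ℝ) : C < vFlow C τ v ∧ flowTime C (vFlow C τ v) = flowTime C v - τ := by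
  obtain ⟨u, hu, hTu⟩ := exists_flowTime_eq hC (flowTime C v - τ)
  exact Function.invFunOn_pos ⟨u, hu, hTu⟩

/-- Characterisation: for `u, v > C`, `vFlow C τ v = u ⟺ T_C(v) − τ = T_C(u)`. [folklore] -/
theorem vFlow_eq_iff {C τ u v : ℝ} (hC : 0 < C) (hu : C < u) : vFlow C τ v = u ↔ flowTime C v - τ = flowTime C u := by
  obtain ⟨hmem, hT⟩ := vFlow_spec hC τ v
  refine ⟨fun h => by rw [← h, hT], fun h => flowTime_injOn hC hmem hu ?_⟩
  rw [hT, h]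

/-- Time `0`: `vFlow C 0 v = v` for `v > C`. [folklore] -/
theorem vFlow_zero {C v : ℝ} (hC : 0 < C) (hv : C < v) : vFlow C 0 v = v :=
  (vFlow_eq_iff hC hv).mpr (sub_zero _)

/-- Flow property: `vFlow C (σ + τ) v = vFlow C τ (vFlow C σ v)`. [folklore] -/
theorem vFlow_add {C : ℝ} (hC : 0 < C) (σ τ v : ℝ) : vFlow C (σ + τ) v = vFlow C τ (vFlow C σ v) := by
  obtain ⟨hmem, hT⟩ := vFlow_spec hC τ (vFlow C σ v)
  refine (vFlow_eq_iff hC hmem).mpr ?_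
  rw [hT, (vFlow_spec hC σ v).2]
  ring

/-- For `τ > 0` the flow moves DOWN: `vFlow C τ v < v` (`v > C`). [folklore] -/
theorem vFlow_lt {C τ v : ℝ} (hC : 0 < C) (hτ : 0 < τ) (hv : C < v) : vFlow C τ v < v := by
  obtain ⟨hmem, hT⟩ := vFlow_spec hC τ v
  exact ((flowTime_strictMonoOn hC).lt_iff_lt hmem hv).mp (by rw [hT]; linarith)

/-- `vFlow` IS the backward flow (uniqueness form): every differentiable solution of `v̇ = (C − v)∕(2v²)` on `[0, τ₀]` staying in `v > C` is
`t ↦ vFlow C t (v 0)` (X16's `hasDerivAt_flowTime_comp`: `T_C(v(t)) + t` is constant). [folklore] -/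
theorem eq_vFlow_of_solution {C : ℝ} (hC : 0 < C) {v v' : ℝ → ℝ} {τ₀ : ℝ}
    (hder : ∀ t ∈ Icc 0 τ₀, HasDerivAt v (v' t) t) (hdom : ∀ t ∈ Icc 0 τ₀, C < v t)
    (hode : ∀ t ∈ Icc 0 τ₀, v' t = (C - v t) / (2 * v t ^ 2)) : ∀ t ∈ Icc 0 τ₀, v t = vFlow C t (v 0) := by
  have hD : ∀ t ∈ Icc 0 τ₀, HasDerivAt (fun s => flowTime C (v s) + s) 0 t := fun t ht =>
    ((hasDerivAt_flowTime_comp hC (hder t ht) (hdom t ht) (hode t ht)).add (hasDerivAt_id' t)).congr_deriv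
      (by norm_num)
  have hconst := constant_of_has_deriv_right_zero (f := fun s => flowTime C (v s) + s) (a := 0) (b := τ₀)
    (fun t ht => (hD t ht).continuousAt.continuousWithinAt) fun t ht => (hD t (Ico_subset_Icc_self ht)).hasDerivWithinAt
  intro t ht
  have h1 : flowTime C (v t) + t = flowTime C (v 0) + 0 := hconst t ht
  symm
  refine (vFlow_eq_iff hC (hdom t ht)).mpr ?_
  linarith

/-! ## §3 The flow `Φ` of `ẇ = C∕√w − 1` on `w > C²` and the block map `M_C(w) = 4·Φ₇(w)` -/

/-- The backward flow of `ẇ = C∕√w − 1` on `w > C²`: `Φ_τ(w) = (vFlow C τ √w)²`. [folklore] -/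
def Phi (C τ w : ℝ) : ℝ := vFlow C τ (Real.sqrt w) ^ 2

/-- The scaled backward ODE block map of the reading note: `M_C(w) = 4·Φ₇(w)`. [folklore] -/
def blockMapODE (C w : ℝ) : ℝ := 4 * Phi C 7 w

/-- `Φ` stays in the domain: `C² < Φ_τ(w)`. [folklore] -/
theorem sq_lt_Phi {C : ℝ} (hC : 0 < C) (τ w : ℝ) : C ^ 2 < Phi C τ w := by
  have h := (vFlow_spec hC τ (Real.sqrt w)).1
  unfold Phi
  gcongr

/-- `√(Φ_τ(w)) = vFlow C τ √w`. [folklore] -/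
theorem sqrt_Phi {C : ℝ} (hC : 0 < C) (τ w : ℝ) : Real.sqrt (Phi C τ w) = vFlow C τ (Real.sqrt w) :=
  Real.sqrt_sq (lt_trans hC (vFlow_spec hC τ _).1).le

/-- `Φ` IS the backward flow of `ẇ = C∕√w − 1` (uniqueness form): every differentiable solution on `[0, τ₀]` staying in `w > C²` is
`t ↦ Phi C t (w 0)` (pass to `v = √w`, `v̇ = ẇ∕(2√w) = (C − v)∕(2v²)`, and use `eq_vFlow_of_solution`). [folklore] -/
theorem eq_Phi_of_solution {C : ℝ} (hC : 0 < C) {w w' : ℝ → ℝ} {τ₀ : ℝ}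
    (hder : ∀ t ∈ Icc 0 τ₀, HasDerivAt w (w' t) t) (hdom : ∀ t ∈ Icc 0 τ₀, C ^ 2 < w t)
    (hode : ∀ t ∈ Icc 0 τ₀, w' t = C / Real.sqrt (w t) - 1) : ∀ t ∈ Icc 0 τ₀, w t = Phi C t (w 0) := by
  have hwpos : ∀ t ∈ Icc 0 τ₀, 0 < w t := fun t ht => lt_trans (by positivity) (hdom t ht)
  have hvdom : ∀ t ∈ Icc 0 τ₀, C < Real.sqrt (w t) := fun t ht =>
    (Real.lt_sqrt hC.le).mpr (hdom t ht)
  have hv := eq_vFlow_of_solution hC (v := fun t => Real.sqrt (w t)) (v' := fun t => w' t / (2 * Real.sqrt (w t)))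
    (τ₀ := τ₀) (fun t ht => (hder t ht).sqrt (hwpos t ht).ne') hvdom fun t ht => by
      have hs : Real.sqrt (w t) ≠ 0 := (Real.sqrt_pos.mpr (hwpos t ht)).ne'
      rw [hode t ht]
      field_simp
  intro t ht
  have h1 : Real.sqrt (w t) = vFlow C t (Real.sqrt (w 0)) := hv t ht
  unfold Phi
  rw [← h1, Real.sq_sqrt (hwpos t ht).le]

/-- FIXED POINTS OF THE BLOCK MAP (`C² < w`): `M_C(w) = w ⟺ 2C < √w ∧ T_C(√w) − T_C(√w∕2) = 7` — an orbit on which `√w` halves in time `7`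
(and `√w∕2` must exceed `C` because the flow never leaves `(C, ∞)`). [folklore] -/
theorem blockMapODE_fixed_iff {C w : ℝ} (hC : 0 < C) (hw : C ^ 2 < w) :
    blockMapODE C w = w ↔ 2 * C < Real.sqrt w ∧ flowTime C (Real.sqrt w) - flowTime C (Real.sqrt w / 2) = 7 := by
  have hw0 : 0 < w := lt_trans (by positivity) hw
  set v := Real.sqrt w with hvdef
  have hv0 : 0 < v := Real.sqrt_pos.mpr hw0
  have hvw : v ^ 2 = w := Real.sq_sqrt hw0.le
  obtain ⟨hmem, hT⟩ := vFlow_spec hC 7 v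
  have hu0 : 0 < vFlow C 7 v := lt_trans hC hmem
  have key : blockMapODE C w = w ↔ vFlow C 7 v = v / 2 := by
    unfold blockMapODE Phi
    rw [← hvdef, ← hvw]
    constructor
    · intro h
      have h' : (2 * vFlow C 7 v) ^ 2 = v ^ 2 := by linarith
      have := (pow_left_inj₀ (by positivity) hv0.le two_ne_zero).mp h'
      linarith
    · intro h
      rw [h]
      ring
  rw [key]
  constructor
  · intro h
    refine ⟨by linarith [h ▸ hmem], ?_⟩
    have := (vFlow_eq_iff hC (h ▸ hmem)).mp h
    linarith
  · rintro ⟨h2C, h7⟩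
    exact (vFlow_eq_iff hC (by linarith)).mpr (by linarith)

/-- THE SADDLE-NODE CRITERION of the reading note, step (5), as a theorem about the defined block map: `M_C` has a fixed point on `w > C²`
iff `C ≤ cStarConj = √(84∕(77 + 72·log 2))`. [folklore] -/
theorem exists_fixedPoint_iff {C : ℝ} (hC : 0 < C) : (∃ w, C ^ 2 < w ∧ blockMapODE C w = w) ↔ C ≤ cStarConj := by
  rw [← exists_halving_iff hC]
  constructor
  · rintro ⟨w, hw, hfix⟩
    obtain ⟨h2C, h7⟩ := (blockMapODE_fixed_iff hC hw).mp hfix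
    exact ⟨Real.sqrt w, h2C, h7⟩
  · rintro ⟨v, hv, h7⟩
    have hv0 : 0 < v := by linarith
    have hw : C ^ 2 < v ^ 2 := by gcongr; linarith
    refine ⟨v ^ 2, hw, (blockMapODE_fixed_iff hC hw).mpr ?_⟩
    rw [Real.sqrt_sq hv0.le]
    exact ⟨hv, h7⟩

/-- A root `x > 2` of X16's profile equation `C²·ψ(x) = 7` gives the fixed point `w = (C·x)²`. [folklore] -/
theorem blockMapODE_fixed_of_root {C x : ℝ} (hC : 0 < C) (hx : 2 < x) (hroot : C ^ 2 * psi x = 7) :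
    blockMapODE C ((C * x) ^ 2) = (C * x) ^ 2 := by
  have hCx : 2 * C < C * x := by nlinarith
  have hw : C ^ 2 < (C * x) ^ 2 := by
    have : C < C * x := by nlinarith
    gcongr
  refine (blockMapODE_fixed_iff hC hw).mpr ?_
  rw [Real.sqrt_sq (by nlinarith), flowTime_sub_half hC hCx, mul_div_cancel_left₀ x hC.ne']
  exact ⟨hCx, hroot⟩

/-- Conversely a fixed point `w > C²` gives the root `x = √w∕C > 2` of `C²·ψ(x) = 7`. [folklore] -/
theorem root_of_blockMapODE_fixed {C w : ℝ} (hC : 0 < C) (hw : C ^ 2 < w) (hfix : blockMapODE C w = w) :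
    2 < Real.sqrt w / C ∧ C ^ 2 * psi (Real.sqrt w / C) = 7 := by
  obtain ⟨h2C, h7⟩ := (blockMapODE_fixed_iff hC hw).mp hfix
  refine ⟨by rwa [lt_div_iff₀ hC], ?_⟩
  rw [← flowTime_sub_half hC h2C]
  exact h7

/-- BELOW the constant: TWO fixed points, one on each side of `w⋆ = (7C∕3)²` (the note's `w₁ < w₂`; `w₁` attracting, `w₂` repelling for the
backward iteration — not proved here). [folklore] -/
theorem exists_two_fixedPoints {C : ℝ} (hC : 0 < C) (hlt : C < cStarConj) :
    ∃ w₁ w₂, C ^ 2 < w₁ ∧ w₁ < (7 * C / 3) ^ 2 ∧ (7 * C / 3) ^ 2 < w₂ ∧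
      blockMapODE C w₁ = w₁ ∧ blockMapODE C w₂ = w₂ := by
  obtain ⟨x₁, x₂, hx₁, hx₁', hx₂', hr₁, hr₂⟩ := exists_two_roots hC hlt
  refine ⟨(C * x₁) ^ 2, (C * x₂) ^ 2, ?_, ?_, ?_, blockMapODE_fixed_of_root hC hx₁ hr₁,
    blockMapODE_fixed_of_root hC (by linarith) hr₂⟩
  · have : C < C * x₁ := by nlinarith
    gcongr
  · have h1 : C * x₁ < 7 * C / 3 := by nlinarith
    have h0 : 0 ≤ C * x₁ := by nlinarith
    gcongr
  · have h1 : 7 * C / 3 < C * x₂ := by nlinarith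
    have h0 : (0 : ℝ) ≤ 7 * C / 3 := by positivity
    gcongr

/-- AT the constant: the fixed point is unique, `w = (7·cStarConj∕3)²` (tangency `√w = (7∕3)·C`). [folklore] -/
theorem fixedPoint_unique_at_cStarConj {w : ℝ} (hw : cStarConj ^ 2 < w) (hfix : blockMapODE cStarConj w = w) :
    w = (7 * cStarConj / 3) ^ 2 := by
  have hC := cStarConj_pos
  obtain ⟨hx, hroot⟩ := root_of_blockMapODE_fixed hC hw hfix
  have hx73 := root_unique_at_cStarConj hx hroot
  have hsw : Real.sqrt w = 7 * cStarConj / 3 := by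
    rw [div_eq_iff hC.ne'] at hx73
    linarith
  rw [← hsw, Real.sq_sqrt (lt_trans (by positivity) hw).le]

/-- AT the constant the tangential point IS a fixed point: `M_{cStarConj}((7·cStarConj∕3)²) = (7·cStarConj∕3)²`. [folklore] -/
theorem blockMapODE_fixed_at_cStarConj : blockMapODE cStarConj ((7 * cStarConj / 3) ^ 2) = (7 * cStarConj / 3) ^ 2 := by
  have hC := cStarConj_pos
  have h : (7 * cStarConj / 3) ^ 2 = (cStarConj * (7 / 3)) ^ 2 := by ring
  rw [h]
  exact blockMapODE_fixed_of_root hC (by norm_num) cStarConj_sq_mul_psiMin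

/-- ABOVE the constant: NO fixed point on `w > C²` (the escape regime of the note — POSSIBLE side). [folklore] -/
theorem no_fixedPoint_of_gt {C w : ℝ} (hlt : cStarConj < C) (hw : C ^ 2 < w) : blockMapODE C w ≠ w := fun hfix =>
  absurd ((exists_fixedPoint_iff (lt_trans cStarConj_pos hlt)).mp ⟨w, hw, hfix⟩) (not_le.mpr hlt)

end

end Summit.QuantumFields.BalabanUV.Gaps.EndDrawdownLinearThresholdFlow
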